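import Summits.BirchSwinnertonDyer.Rank1Residual.Additive.X4TamDefectLevelLoweringFromWiles
import Summits.BirchSwinnertonDyer.Rank1Residual.Additive.X4TamDefectLevelLoweringFromWilesMinus
import HarnessLib

/-!
# The Eichler–Shimura dictionary nodes WITH the irreducibility package, and the re-keyed ENDs (cell `b2b-bsdres`, seat additive-p4, line V44; print-police finding (F1)/(F1′) of n1011-lit)

HONEST FRAMING (verbatim, cell `b2b-bsdres`): the goal of the cell is to DELETE the COMBINATION-SHAPED
residual classes for ALL analytic-rank `≤ 1` curves over `ℚ` — "full BSD formula for every rank `≤ 1`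
curve in class `C`" assembled STRICTLY from published theorems — so that the rank-`≤ 1` remainder
becomes exactly the CONSTRUCTION-SHAPED classes, which are TYPED (missing-input Props), NOT attempted;
this is not "finishing BSD". This file: two typed targets (`@[conjecture] def`, asserting nothing) —
the APPEND-ONLY repair of gen 24's Eichler–Shimura dictionary nodes
`LevelLowering.EichlerShimuraModPMultiplicityOne{,Minus}` — and the two re-keyed ENDs consuming them.
Nothing booked; X4 CONSTRUCTION-SHAPED; no Literature fact minted.

## The finding and the repair

FINDING (n1011-lit, print review of p318435, 2026-08-22): the landed node
`EichlerShimuraModPMultiplicityOne N p χ θ` binds `χ(T_q) = θ q`, `p ∈ ker χ`, `ker χ` maximal,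
`dim_{𝕋/ker χ} J₀(N)[ker χ] = 2` and the rider, and concludes (MO) `ModPMultiplicityOne k N θ`; but the
dictionary's own mechanism (the boundary symbols are EISENSTEIN and die after localisation at a
NON-Eisenstein `𝔪`, Darmon–Diamond–Taylor Lemma 4.30 (a), p. 136) needs `𝔪 = ker χ` non-Eisenstein,
which is NOT a binder — and the binders ARE satisfiable at an Eisenstein `𝔪`: Mazur 1977, Cor. II.16.3
(p. 125) gives `dim J₀(N)[𝔓] = 2` at the Eisenstein prime `𝔓` of prime level `N`, where the
`θ_Eis`-eigen plus symbols contain the boundary symbol on top of the cuspidal part. So some instance of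
the landed target claims more than the cited dictionary delivers.

REPAIR (this file, new names, old nodes untouched — they assert nothing):
`EichlerShimuraModPMultiplicityOneOfIrreducible N p χ θ` inserts, between the `finrank … = 2` line and
the rider, EXACTLY the Galois package of the printed multiplicity-one theorem
(`wiles1995_multiplicityOne`, DDT Thm. 4.26) at `𝔪 := ker χ`, `ℓ := p`: for every field `k'`, every
`ι' : 𝕋/ker χ →+* k'` and every `ρ : ModPGaloisRep ℚ k' 2` unramified outside `N p` with
`charpoly ρ(Frob_q) = X² − (T_q mod ker χ) X + q`, IF `ρ` is irreducible THEN (rider →) (MO). Universal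
over the witness = an existential hypothesis (the conclusion does not mention `k', ι', ρ`). By
Darmon–Diamond–Taylor Lemma 4.12 (p. 120: "`ρ_𝔪` absolutely irreducible ⟺ `𝔪̃` not Eisenstein",
`ℓ` odd) every instance now sits inside the printed dictionary; the ENDs discharge the new binders
with the terms `k' ι' ρ hρ hρirr` they ALREADY hold for the fact. `…OfIrreducible_of_eichlerShimura…`
records that the repaired node is implied by (is weaker than) the landed one. Minus twin alike.

## The re-keyed ENDs

`X4.bsdp_of_wiles1995_irreducible_quadraticTwist_of_pos_of_five_le` (even twists `d > 0`) and
`X4.bsdp_of_wiles1995_irreducible_quadraticTwist_of_neg_of_five_le` (odd twists `d < 0`): gen 24's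
re-keyed ENDs verbatim with the dictionary binder replaced by the repaired node; the line
`hES hχ₀ hp𝔪 h𝔪 hfin (Or.inl _)` becomes `hES hχ₀ hp𝔪 h𝔪 hfin k' ι' ρ hρ hρirr (Or.inl _)`.
Inputs otherwise unchanged: `wiles1995_multiplicityOne` BY NAME, Kim 2026 Thm. 1.8 (6), Cassels–Tate,
GZK, modularity (PUBLISHED named facts), (OLD)/(OLD⁻) at the Tamagawa prime, numerals.

## References

* H. Darmon, F. Diamond, R. Taylor, *Fermat's Last Theorem* (1995), Thm. 4.26 (§4.5 p. 134), Lemma 4.12 (p. 120), Lemma 4.30 (a) (p. 136). [cite: DarmonDiamondTaylor1995, Thm. 4.26 (§4.5, p. 134) and Lemma 4.12 (p. 120)]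
* B. Mazur, *Modular curves and the Eisenstein ideal*, Publ. Math. IHÉS 47 (1977), Cor. II.16.3 (p. 125). [cite: Mazur1977, Cor. II.16.3]
* A. Ash, G. Stevens, Duke Math. J. 53 (1986), §4. [cite: AshStevens1986, §4]
* Ju. I. Manin (1972), Thm. 1.9. [cite: Manin1972, Thm. 1.9]
* C.-H. Kim, Amer. J. Math. 148 (2026) = arXiv:2203.12159, Thm. 1.9 (6), Conj. 1.10. [cite: Kim2022StructureSelmer, Thm. 1.9 (6) and Conj. 1.10 (PDF p. 8)]
-/

noncomputable section

open scoped MatrixGroups ModularForm NumberTheorySymbols NumberField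

open CongruenceSubgroup Finset IsDedekindDomain Polynomial

open Literature.NumberTheory.EllipticCurves Literature.NumberTheory.EllipticCurves.ModularForms

namespace Summit.BirchSwinnertonDyer.Rank1Residual.LevelLowering

open Literature.NumberTheory.GaloisRepresentations Rat.HeightOneSpectrum

/-! ### §1 The dictionary nodes with the irreducibility package -/

section Dictionary

variable {k : Type*} [CommRing k] (N : ℕ) [NeZero N] (p : ℕ) (χ : HeckeRing0 N 2 →+* k) (θ : ℕ → k)

/-- **EICHLER–SHIMURA mod-`p` DICTIONARY WITH THE IRREDUCIBILITY PACKAGE (typed target).** For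
`χ : 𝕋_ℤ(N) → k` with `χ(T_q) = θ(q)` at every prime `q`, `p ∈ ker χ`, `ker χ` maximal, the printed
multiplicity-one CONCLUSION `dim_{𝕋/ker χ} J₀(N)[ker χ] = 2` (DDT Thm. 4.26 over `J0 N`), AND the
printed theorem's Galois package at `𝔪 = ker χ` — some `ρ : G_ℚ → GL₂(k')` (`k' ⊇ 𝕋/ker χ` a field)
unramified outside `N p` with `charpoly ρ(Frob_q) = X² − (T_q mod ker χ) X + q`, IRREDUCIBLE (so
`ker χ` is non-Eisenstein, DDT Lemma 4.12, and the boundary symbols die after localisation, DDT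
Lemma 4.30 (a)) — imply (MO) `ModPMultiplicityOne k N θ`, granted the rider `ES-dict-p3-elliptic`
(`p ≠ 3 ∨ 9 ∣ N ∨` some prime `q ∣ N`, `q ≡ 2 (mod 3)`). Standard but NOT typed in the tree: A
TARGET; nothing asserted. Repairs `EichlerShimuraModPMultiplicityOne` (which omits the package and is
satisfiable at Eisenstein `𝔪`, Mazur 1977 Cor. II.16.3).
[cite: DarmonDiamondTaylor1995, Thm. 4.26 (§4.5, p. 134) and Lemma 4.12 (p. 120)]
[cite: AshStevens1986, §4] [cite: Manin1972, Thm. 1.9] -/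
@[conjecture] def EichlerShimuraModPMultiplicityOneOfIrreducible : Prop :=
  (∀ (q : ℕ) (hq : q.Prime), χ (HeckeRing0.T N 2 q hq) = θ q) →
    (p : HeckeRing0 N 2) ∈ RingHom.ker χ → (RingHom.ker χ).IsMaximal →
    Module.finrank (HeckeRing0 N 2 ⧸ RingHom.ker χ)
        (Submodule.torsionBySet (HeckeRing0 N 2) (J0 N) (RingHom.ker χ : Set (HeckeRing0 N 2))) = 2 →
    ∀ (k' : Type) [Field k'] [TopologicalSpace k'] [DiscreteTopology k']
      (ι' : HeckeRing0 N 2 ⧸ RingHom.ker χ →+* k') (ρ : ModPGaloisRep ℚ k' 2),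
      (∀ v : HeightOneSpectrum (𝓞 ℚ), ¬ ((primesEquiv v : Nat.Primes) : ℕ) ∣ N * p →
        ρ.IsUnramifiedAt v ∧
          ρ.HasFrobCharpolyAt v
            (X ^ 2
              - C (ι' (Ideal.Quotient.mk (RingHom.ker χ) (HeckeRing0.T N 2
                  ((primesEquiv v : Nat.Primes) : ℕ) (primesEquiv v : Nat.Primes).2))) * X
              + C (((primesEquiv v : Nat.Primes) : ℕ) : k'))) →
      FramedRep.IsIrreducible ρ →
    (p ≠ 3 ∨ 9 ∣ N ∨ ∃ q : ℕ, q.Prime ∧ q ∣ N ∧ q % 3 = 2) →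
    ModPMultiplicityOne k N θ

/-- **MINUS PART, WITH THE IRREDUCIBILITY PACKAGE (typed target).** As
`EichlerShimuraModPMultiplicityOneOfIrreducible` with the conclusion (MO⁻) `ModPMultiplicityOneMinus k N θ`
(the `θ`-eigen MINUS subspace of `Symb_{Γ₀(N)}(Sym⁰ k)` has dimension `≤ 1`). A TARGET; nothing
asserted. Repairs `EichlerShimuraModPMultiplicityOneMinus`.
[cite: DarmonDiamondTaylor1995, Thm. 4.26 (§4.5, p. 134) and Lemma 4.12 (p. 120)]
[cite: AshStevens1986, §4] [cite: Manin1972, Thm. 1.9] -/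
@[conjecture] def EichlerShimuraModPMultiplicityOneMinusOfIrreducible : Prop :=
  (∀ (q : ℕ) (hq : q.Prime), χ (HeckeRing0.T N 2 q hq) = θ q) →
    (p : HeckeRing0 N 2) ∈ RingHom.ker χ → (RingHom.ker χ).IsMaximal →
    Module.finrank (HeckeRing0 N 2 ⧸ RingHom.ker χ)
        (Submodule.torsionBySet (HeckeRing0 N 2) (J0 N) (RingHom.ker χ : Set (HeckeRing0 N 2))) = 2 →
    ∀ (k' : Type) [Field k'] [TopologicalSpace k'] [DiscreteTopology k']
      (ι' : HeckeRing0 N 2 ⧸ RingHom.ker χ →+* k') (ρ : ModPGaloisRep ℚ k' 2),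
      (∀ v : HeightOneSpectrum (𝓞 ℚ), ¬ ((primesEquiv v : Nat.Primes) : ℕ) ∣ N * p →
        ρ.IsUnramifiedAt v ∧
          ρ.HasFrobCharpolyAt v
            (X ^ 2
              - C (ι' (Ideal.Quotient.mk (RingHom.ker χ) (HeckeRing0.T N 2
                  ((primesEquiv v : Nat.Primes) : ℕ) (primesEquiv v : Nat.Primes).2))) * X
              + C (((primesEquiv v : Nat.Primes) : ℕ) : k'))) →
      FramedRep.IsIrreducible ρ →
    (p ≠ 3 ∨ 9 ∣ N ∨ ∃ q : ℕ, q.Prime ∧ q ∣ N ∧ q % 3 = 2) →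
    ModPMultiplicityOneMinus k N θ

variable {N p χ θ}

/-- If (MO) holds outright, the repaired dictionary target holds (vacuity). [folklore] -/
theorem eichlerShimuraModPMultiplicityOneOfIrreducible_of_modPMultiplicityOne
    (h : ModPMultiplicityOne k N θ) : EichlerShimuraModPMultiplicityOneOfIrreducible N p χ θ :=
  fun _ _ _ _ _ _ _ _ _ _ _ _ _ ↦ h

/-- The repaired node is WEAKER than (implied by) gen 24's node `EichlerShimuraModPMultiplicityOne`
(it only adds hypotheses). [folklore] -/
theorem eichlerShimuraModPMultiplicityOneOfIrreducible_of_eichlerShimuraModPMultiplicityOne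
    (h : EichlerShimuraModPMultiplicityOne N p χ θ) :
    EichlerShimuraModPMultiplicityOneOfIrreducible N p χ θ :=
  fun hχ hp h𝔪 hfin _ _ _ _ _ _ _ _ hr ↦ h hχ hp h𝔪 hfin hr

/-- If (MO⁻) holds outright, the repaired minus target holds (vacuity). [folklore] -/
theorem eichlerShimuraModPMultiplicityOneMinusOfIrreducible_of_modPMultiplicityOneMinus
    (h : ModPMultiplicityOneMinus k N θ) :
    EichlerShimuraModPMultiplicityOneMinusOfIrreducible N p χ θ :=
  fun _ _ _ _ _ _ _ _ _ _ _ _ _ ↦ h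

/-- The repaired minus node is implied by gen 24's `EichlerShimuraModPMultiplicityOneMinus`. [folklore] -/
theorem eichlerShimuraModPMultiplicityOneMinusOfIrreducible_of_eichlerShimuraModPMultiplicityOneMinus
    (h : EichlerShimuraModPMultiplicityOneMinus N p χ θ) :
    EichlerShimuraModPMultiplicityOneMinusOfIrreducible N p χ θ :=
  fun hχ hp h𝔪 hfin _ _ _ _ _ _ _ _ hr ↦ h hχ hp h𝔪 hfin hr

end Dictionary

end Summit.BirchSwinnertonDyer.Rank1Residual.LevelLowering

/-! ### §2 The re-keyed ENDs over the repaired nodes -/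

namespace Summit.BirchSwinnertonDyer.Rank1Residual.X4

open Complex WeierstrassCurve Literature.NumberTheory.EllipticCurves.Rank1Residual
  Literature.NumberTheory.EllipticCurves.Rank1Residual.Typed
  Summit.BirchSwinnertonDyer.Rank1Residual.Additive
  Summit.BirchSwinnertonDyer.Rank1Residual.LevelLowering
  Literature.NumberTheory.GaloisRepresentations Rat.HeightOneSpectrum

variable {k : Type*} [CommRing k] [Nontrivial k]
  (W₀ W : WeierstrassCurve ℚ) [W₀.IsElliptic] [W₀.IsGloballyMinimal] [W.IsElliptic] [W.IsGloballyMinimal]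
  (p : ℕ) [hp5 : Fact p.Prime] (ι : ZMod p →+* k)

/-- **TAM-DEFECT₂ ON THE TWIST-GOOD LOCUS FROM THE PRINTED MULTIPLICITY-ONE THEOREM, even twists
`d > 0`, over the REPAIRED dictionary node.** Gen 24's `bsdp_of_wiles1995_quadraticTwist_of_pos_of_five_le`
with `EichlerShimuraModPMultiplicityOne` replaced by `EichlerShimuraModPMultiplicityOneOfIrreducible`;
the node's irreducibility package is fed with the very terms `k' ι' ρ hρ hρirr` the END holds for
`wiles1995_multiplicityOne` (BY NAME). All other inputs unchanged: Kim 2026 Thm. 1.8 (6), Cassels–Tate,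
GZK, modularity (PUBLISHED) + (OLD) at the Tamagawa prime `ℓ` + numerals ⟹ **`BSD(E,p)`**. Nothing booked.
[cite: DarmonDiamondTaylor1995, Thm. 4.26 (§4.5, p. 134) and Lemma 4.12 (p. 120)]
[cite: Kim2022StructureSelmer, Thm. 1.9 (6) and Conj. 1.10 (PDF p. 8)]
[cite: Ribet1990, Thm. 1.1 and Thm. 5.2 (b)] [cite: SilvermanAEC2009, Thm. X.4.14] -/
theorem bsdp_of_wiles1995_irreducible_quadraticTwist_of_pos_of_five_le
    (hW1 : wiles1995_multiplicityOne)
    (hKimk : Kim2026.rankZero_le_padicValNat_sha_of_kuriharaNumber_ne_zero)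
    (hE67c : Kim2026.rankZero_padicValNat_sha_add_le_of_forall_pow_dvd_kuriharaNumber_cyclicLevel)
    (hCT : exists_casselsTate_pairing (K := ℚ))
    (hGZK : rank_eq_analyticRank_of_analyticRank_le_one) (hmod : hasEntireLFunction_rat)
    (hp : 5 ≤ p) (hr : W.analyticRank = 0) (hsurj : W.HasSurjectiveModNGaloisRep p)
    {N : ℕ} [NeZero N] (D : ModularParametrizationData W N) (hN : W.conductorNorm ℤ = N)
    (hc : ¬ (p : ℤ) ∣ D.maninConstant)
    (hper : ∃ u : ℚ, ‖(u : ℚ_[p])‖ = 1 ∧ W.realPeriodRat = u * plusPeriod D.f)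
    {q' : ℚ} (hq' : shaAn W = (q' : ℂ)) (hv : padicValRat p q' = 0)
    (hc2 : padicValNat p W.tamagawaProduct ≤ 2)
    -- the geometric twist datum
    {d : ℤ} (hd4 : d % 4 = 1) (hsq : Squarefree d) (hd : 0 < d) (C : VariableChange ℚ)
    (hC : C • W₀.quadraticTwist (d : ℚ) = W)
    (hgm : ∀ v : HeightOneSpectrum (𝓞 ℚ), ((Rat.HeightOneSpectrum.primesEquiv v : ℕ) : ℤ) ∣ d →
      W₀.HasGoodReductionAt v ∨ W₀.HasMultiplicativeReductionAt v)
    {N₀ : ℕ} [NeZero N₀] [NeZero d.natAbs] {f₀ : CuspForm (Gamma0 N₀) 2} (hf₀ : IsNewformOf W₀ f₀)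
    (hN₀ : N₀ ∣ N) (hm : d.natAbs ^ 2 ∣ N) (hmN : d.natAbs ∣ W.conductorNorm ℤ)
    (hper₀ : ∃ u : ℚ, ‖(u : ℚ_[p])‖ = 1 ∧ W₀.realPeriodRat = u * plusPeriod f₀)
    (hirr₀ : W₀.HasIrreducibleModPGaloisRep p)
    -- (MO) from print: the eigencharacter, the printed hypotheses of DDT Thm. 4.26, the repaired dictionary
    (χ₀ : HeckeRing0 N₀ 2 →+* k)
    (hχ₀ : ∀ (q : ℕ) (hq : q.Prime), χ₀ (HeckeRing0.T N₀ 2 q hq) = ι ((W₀.LFunction q : ℤ) : ZMod p))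
    (hp𝔪 : (p : HeckeRing0 N₀ 2) ∈ RingHom.ker χ₀) (h𝔪 : (RingHom.ker χ₀).IsMaximal)
    (hpN₀ : ¬ p ∣ N₀ ∨ (¬ p ^ 2 ∣ N₀ ∧ HeckeRing0.T N₀ 2 p hp5.out ∉ RingHom.ker χ₀))
    (k' : Type) [Field k'] [TopologicalSpace k'] [DiscreteTopology k']
    (ι' : HeckeRing0 N₀ 2 ⧸ RingHom.ker χ₀ →+* k') (ρ : ModPGaloisRep ℚ k' 2)
    (hρ : ∀ v : HeightOneSpectrum (𝓞 ℚ), ¬ ((primesEquiv v : Nat.Primes) : ℕ) ∣ N₀ * p →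
        ρ.IsUnramifiedAt v ∧
          ρ.HasFrobCharpolyAt v
            (X ^ 2
              - Polynomial.C (ι' (Ideal.Quotient.mk (RingHom.ker χ₀) (HeckeRing0.T N₀ 2
                  ((primesEquiv v : Nat.Primes) : ℕ) (primesEquiv v : Nat.Primes).2))) * X
              + Polynomial.C (((primesEquiv v : Nat.Primes) : ℕ) : k')))
    (hρirr : FramedRep.IsIrreducible ρ)
    (hES : EichlerShimuraModPMultiplicityOneOfIrreducible N₀ p χ₀
      (fun q ↦ ι ((W₀.LFunction q : ℤ) : ZMod p)))
    -- (OLD) at the Tamagawa prime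
    {ℓ : ℕ} {w : k} {μ : ℚ → k} (hℓN : ℓ ∣ W.conductorNorm ℤ) (hℓ : ℓ.Coprime d.natAbs)
    (hOLD : HasOldEigenPlusSymb k N₀ (fun q ↦ ι ((W₀.LFunction q : ℤ) : ZMod p)) ℓ w μ)
    (hμ : IsPeriodic μ)
    (hH : ∀ q : ℕ, Kato.IsKolyvaginPrime W p 1 q → HeckeRel μ q (ι ((W₀.LFunction q : ℤ) : ZMod p)))
    (hw : w * ι ((J((ℓ : ℤ) | d.natAbs) : ℤ) : ZMod p) = 1) : BSDp W p := by
  -- DDT Thm. 4.26 at `𝔪₀ = ker χ₀`: `dim_{𝕋/𝔪₀} J₀(N₀)[𝔪₀] = 2`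
  have hp2 : p ≠ 2 := by omega
  have hfin := (hW1 N₀ p hp2 (RingHom.ker χ₀) h𝔪 hp𝔪 k' ι' ρ hρ hρirr hpN₀).1
  -- the repaired dictionary: (MO), the package fed with the fact's own witness (rider moot at `p ≥ 5`)
  have hMO : ModPMultiplicityOne k N₀ (fun q ↦ ι ((W₀.LFunction q : ℤ) : ZMod p)) :=
    hES hχ₀ hp𝔪 h𝔪 hfin k' ι' ρ hρ hρirr (Or.inl (by omega))
  exact bsdp_of_multiplicityOne_quadraticTwist_of_pos_of_five_le W₀ W p ι hKimk hE67c hCT hGZK hmod hp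
    hr hsurj D hN hc hper hq' hv hc2 hd4 hsq hd C hC hgm hf₀ hN₀ hm hmN hper₀ hirr₀ hMO hℓN hℓ hOLD hμ
    hH hw

/-- **TAM-DEFECT₂ ON THE TWIST-GOOD LOCUS, ODD TWIST `d < 0`, FROM THE PRINTED MULTIPLICITY-ONE
THEOREM, over the REPAIRED minus dictionary node.** Gen 24's
`bsdp_of_wiles1995_quadraticTwist_of_neg_of_five_le` with `EichlerShimuraModPMultiplicityOneMinus`
replaced by `EichlerShimuraModPMultiplicityOneMinusOfIrreducible` (package fed with `k' ι' ρ hρ hρirr`).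
All other inputs unchanged: `wiles1995_multiplicityOne` (BY NAME), Kim 2026 Thm. 1.8 (6), Cassels–Tate,
GZK, modularity (PUBLISHED) + the minus-symbol integrality numeral + (OLD⁻) at the Tamagawa prime `ℓ`
+ numerals ⟹ **`BSD(E,p)`**. Nothing booked.
[cite: DarmonDiamondTaylor1995, Thm. 4.26 (§4.5, p. 134) and Lemma 4.12 (p. 120)]
[cite: Kim2022StructureSelmer, Thm. 1.9 (6) and Conj. 1.10 (PDF p. 8)]
[cite: Ribet1990, Thm. 1.1 and Thm. 5.2 (b)] [cite: SilvermanAEC2009, Thm. X.4.14] -/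
theorem bsdp_of_wiles1995_irreducible_quadraticTwist_of_neg_of_five_le
    (hW1 : wiles1995_multiplicityOne)
    (hKimk : Kim2026.rankZero_le_padicValNat_sha_of_kuriharaNumber_ne_zero)
    (hE67c : Kim2026.rankZero_padicValNat_sha_add_le_of_forall_pow_dvd_kuriharaNumber_cyclicLevel)
    (hCT : exists_casselsTate_pairing (K := ℚ))
    (hGZK : rank_eq_analyticRank_of_analyticRank_le_one) (hmod : hasEntireLFunction_rat)
    (hp : 5 ≤ p) (hr : W.analyticRank = 0) (hsurj : W.HasSurjectiveModNGaloisRep p)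
    {N : ℕ} [NeZero N] (D : ModularParametrizationData W N) (hN : W.conductorNorm ℤ = N)
    (hc : ¬ (p : ℤ) ∣ D.maninConstant)
    (hper : ∃ u : ℚ, ‖(u : ℚ_[p])‖ = 1 ∧ W.realPeriodRat = u * plusPeriod D.f)
    {q' : ℚ} (hq' : shaAn W = (q' : ℂ)) (hv : padicValRat p q' = 0)
    (hc2 : padicValNat p W.tamagawaProduct ≤ 2)
    {d : ℤ} (hd4 : d % 4 = 1) (hsq : Squarefree d) (hd : d < 0) (C : VariableChange ℚ)
    (hC : C • W₀.quadraticTwist (d : ℚ) = W)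
    (hgm : ∀ v : HeightOneSpectrum (𝓞 ℚ), ((Rat.HeightOneSpectrum.primesEquiv v : ℕ) : ℤ) ∣ d →
      W₀.HasGoodReductionAt v ∨ W₀.HasMultiplicativeReductionAt v)
    {N₀ : ℕ} [NeZero N₀] [NeZero d.natAbs] {f₀ : CuspForm (Gamma0 N₀) 2} (hf₀ : IsNewformOf W₀ f₀)
    (hN₀ : N₀ ∣ N) (hm : d.natAbs ^ 2 ∣ N) (hmN : d.natAbs ∣ W.conductorNorm ℤ)
    (hper₀ : ∃ u : ℚ, ‖(u : ℚ_[p])‖ = 1 ∧ W₀.imaginaryPeriodRat = u * minusPeriod f₀)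
    (hint : ∀ x : ℚ, ¬ p ∣ (ratMinusSymbol f₀ x).den)
    -- (MO⁻) from print, over the repaired minus node
    (χ₀ : HeckeRing0 N₀ 2 →+* k)
    (hχ₀ : ∀ (q : ℕ) (hq : q.Prime), χ₀ (HeckeRing0.T N₀ 2 q hq) = ι ((W₀.LFunction q : ℤ) : ZMod p))
    (hp𝔪 : (p : HeckeRing0 N₀ 2) ∈ RingHom.ker χ₀) (h𝔪 : (RingHom.ker χ₀).IsMaximal)
    (hpN₀ : ¬ p ∣ N₀ ∨ (¬ p ^ 2 ∣ N₀ ∧ HeckeRing0.T N₀ 2 p hp5.out ∉ RingHom.ker χ₀))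
    (k' : Type) [Field k'] [TopologicalSpace k'] [DiscreteTopology k']
    (ι' : HeckeRing0 N₀ 2 ⧸ RingHom.ker χ₀ →+* k') (ρ : ModPGaloisRep ℚ k' 2)
    (hρ : ∀ v : HeightOneSpectrum (𝓞 ℚ), ¬ ((primesEquiv v : Nat.Primes) : ℕ) ∣ N₀ * p →
        ρ.IsUnramifiedAt v ∧
          ρ.HasFrobCharpolyAt v
            (X ^ 2
              - Polynomial.C (ι' (Ideal.Quotient.mk (RingHom.ker χ₀) (HeckeRing0.T N₀ 2
                  ((primesEquiv v : Nat.Primes) : ℕ) (primesEquiv v : Nat.Primes).2))) * X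
              + Polynomial.C (((primesEquiv v : Nat.Primes) : ℕ) : k')))
    (hρirr : FramedRep.IsIrreducible ρ)
    (hES : EichlerShimuraModPMultiplicityOneMinusOfIrreducible N₀ p χ₀
      (fun q ↦ ι ((W₀.LFunction q : ℤ) : ZMod p)))
    -- (OLD⁻) at the Tamagawa prime
    {ℓ : ℕ} {w : k} {μ : ℚ → k} (hℓN : ℓ ∣ W.conductorNorm ℤ) (hℓ : ℓ.Coprime d.natAbs)
    (hOLD : HasOldEigenMinusSymb k N₀ (fun q ↦ ι ((W₀.LFunction q : ℤ) : ZMod p)) ℓ w μ)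
    (hμ : IsPeriodic μ)
    (hH : ∀ q : ℕ, Kato.IsKolyvaginPrime W p 1 q → HeckeRel μ q (ι ((W₀.LFunction q : ℤ) : ZMod p)))
    (hw : w * ι ((J((ℓ : ℤ) | d.natAbs) : ℤ) : ZMod p) = 1) : BSDp W p := by
  have hp2 : p ≠ 2 := by omega
  have hfin := (hW1 N₀ p hp2 (RingHom.ker χ₀) h𝔪 hp𝔪 k' ι' ρ hρ hρirr hpN₀).1
  have hMO : ModPMultiplicityOneMinus k N₀ (fun q ↦ ι ((W₀.LFunction q : ℤ) : ZMod p)) :=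
    hES hχ₀ hp𝔪 h𝔪 hfin k' ι' ρ hρ hρirr (Or.inl (by omega))
  exact bsdp_of_multiplicityOneMinus_quadraticTwist_of_neg_of_five_le W p ι W₀ hKimk hE67c hCT hGZK hmod
    hp hr hsurj D hN hc hper hq' hv hc2 hd4 hsq hd C hC hgm hf₀ hN₀ hm hmN hper₀ hint hMO hℓN hℓ hOLD hμ
    hH hw

end Summit.BirchSwinnertonDyer.Rank1Residual.X4

end
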